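import Summits.HubbardSuperconductivity.HubbardSuperconductivity.Theorems.AnisotropyChordInsertionEntropyRoute
import Summits.HubbardSuperconductivity.HubbardSuperconductivity.Theorems.AnisotropyChordXXZAutInvariance
import Summits.HubbardSuperconductivity.HubbardSuperconductivity.Theorems.AnisotropyChordSpinMonotoneCompleteMultipartite
import Literature.Probability.LatticeModels.TorusBipartite
import Literature.Probability.LatticeModels.IsingTransport
import Summits.HubbardSuperconductivity.HubbardSuperconductivity.Theorems.AnisotropyChordEnergyConvexAllGraphs

/-!
# Route `AnisotropyChord` / H0 rotor rung: `UniformSiteDensity` HOLDS — the Perron sector ground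
# amplitudes of the XXZ torus have uniform site density `⟨n_x⟩ = 1/2 + M/L²` (translation covariance;
# discharges a support hypothesis of the entropy-route link `eventualCondensate_of_insertionEntropyBound`)

* `torusTranslationIso L v : torusGraph 2 L ≃g torusGraph 2 L` — translations are automorphisms
  (`torusGraph_adj_add_right`);
* `perronAmplitude_comp_iso` — a Perron sector ground amplitude (`IsPerronSectorGroundAmplitude`) is
  invariant under every automorphism of the torus graph (`xxz_sectorGroundState_comp_iso`);
* `siteDensity_comp_equiv` — for an invariant amplitude the site density is invariant;
* `sum_siteDensity_eq` — `Σ_x ρ_x = L²/2 + M` (number of particles, from the sector constraint);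
* **`uniformSiteDensity_holds : ∀ Δ M, UniformSiteDensity Δ M`** — for EVERY `L ≥ 1`, not only eventually;
* `exists_perronAmplitude`, `perronSectorExists_of_ne_bot` — `PerronSectorExists` from non-triviality of
  the reference sectors (reducible Perron–Frobenius, normalised).

Theory seat memo ROTOR-THEORY-7 §84 («provable: uniqueness of the Perron vector + translation invariance of
`H(Δ)`»).  Tasaki (2020) §2.2.
-/

set_option linter.dupNamespace false

noncomputable section

namespace Summit.HubbardSuperconductivity.HubbardSuperconductivity.Theorems.AnisotropyChord.InsertionEntropy

open Matrix Complex Finset Filter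
open Literature.MathematicalPhysics.QuantumLattice Literature.Probability.LatticeModels
open Summit.HubbardSuperconductivity.HubbardSuperconductivity.Theorems.AnisotropyChord

/-- Translation by `v` is an automorphism of the torus graph `(ℤ/L)²`. [folklore] -/
def torusTranslationIso (L : ℕ) (v : TorusSite 2 L) : torusGraph 2 L ≃g torusGraph 2 L where
  toEquiv := Equiv.addRight v
  map_rel_iff' := by
    intro x y
    exact torusGraph_adj_add_right v x y

section General

variable {V : Type} [Fintype V] [DecidableEq V]

/-- Reindexing configuration sums along `τ ↦ τ ∘ φ`. [folklore] -/
theorem sum_config_comp_equiv {β : Type*} [AddCommMonoid β] (φ : V ≃ V) (f : (V → Fin 2) → β) :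
    (∑ τ : V → Fin 2, f (τ ∘ φ)) = ∑ τ : V → Fin 2, f τ := by
  have key : ∀ τ : V → Fin 2, (φ.symm.arrowCongr (Equiv.refl (Fin 2))) τ = τ ∘ φ := by
    intro τ; funext x; simp [Equiv.arrowCongr_apply]
  calc (∑ τ : V → Fin 2, f (τ ∘ φ)) = ∑ τ, f ((φ.symm.arrowCongr (Equiv.refl (Fin 2))) τ) :=
        Finset.sum_congr rfl fun τ _ => by rw [key]
    _ = ∑ τ, f τ := Equiv.sum_comp _ _

/-- **Site densities of an automorphism-invariant amplitude are invariant:** if `a (σ ∘ φ) = a σ` for all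
`σ` then `ρ_{φ x} = ρ_x`. [folklore] -/
theorem siteDensity_comp_equiv (φ : V ≃ V) (a : (V → Fin 2) → ℝ) (ha : ∀ σ, a (σ ∘ φ) = a σ) (x : V) :
    siteDensity a (φ x) = siteDensity a x := by
  unfold siteDensity
  have ha' : ∀ τ : V → Fin 2, a (τ ∘ φ.symm) = a τ := by
    intro τ
    have h := ha (τ ∘ φ.symm)
    rw [Function.comp_assoc, Equiv.symm_comp_self, Function.comp_id] at h
    exact h.symm
  refine Fintype.sum_equiv (φ.symm.arrowCongr (Equiv.refl (Fin 2))) _ _ fun σ => ?_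
  have he : (φ.symm.arrowCongr (Equiv.refl (Fin 2))) σ = σ ∘ φ := by
    funext y; simp [Equiv.arrowCongr_apply]
  rw [he]
  show (if σ (φ x) = 0 then a σ ^ 2 else 0) = if (σ ∘ φ) x = 0 then a (σ ∘ φ) ^ 2 else 0
  rw [ha σ]
  rfl

/-- On the support of a sector vector the number of particles (`σ x = 0`) is `|V|/2 + M`. [folklore] -/
theorem card_filter_eq_zero_of_mem_sector {M : ℝ} {ψ : (V → Fin 2) → ℂ}
    (hψ : ψ ∈ spinZSector (Λ := V) 1 M) {σ : V → Fin 2} (hσ : ψ σ ≠ 0) :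
    ((Finset.univ.filter fun x => σ x = 0).card : ℝ) = (Fintype.card V : ℝ) / 2 + M := by
  have h := (LiebMattis.mem_spinZSector_iff 1 M ψ).1 hψ σ hσ
  -- real parts: Σ_x (1/2 − σ x) = M
  have hre := congrArg Complex.re h
  rw [Complex.re_sum, Complex.ofReal_re] at hre
  have hterm : ∀ x, (((((1 : ℕ) : ℂ)) / 2 - ((σ x : ℕ) : ℂ)).re) = (1 : ℝ) / 2 - ((σ x : ℕ) : ℝ) := by
    intro x
    have e : (((1 : ℕ) : ℂ)) / 2 - ((σ x : ℕ) : ℂ) = (((1 : ℝ) / 2 - ((σ x : ℕ) : ℝ) : ℝ) : ℂ) := by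
      push_cast; ring
    rw [e, Complex.ofReal_re]
  simp_rw [hterm] at hre
  rw [Finset.sum_sub_distrib, Finset.sum_const, Finset.card_univ, nsmul_eq_mul] at hre
  have hones : (∑ x, ((σ x : ℕ) : ℝ)) = ((Finset.univ.filter fun x => σ x = 1).card : ℝ) := by
    rw [Finset.card_filter]; push_cast
    exact Finset.sum_congr rfl fun x _ => by
      rcases Fin.exists_fin_two.mp ⟨σ x, rfl⟩ with h0 | h1 <;> simp [*]
  have hsplit : ((Finset.univ.filter fun x => σ x = 0).card : ℝ) +
      ((Finset.univ.filter fun x => σ x = 1).card : ℝ) = (Fintype.card V : ℝ) := by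
    have h2 : (Finset.univ.filter fun x => σ x = 0) = (Finset.univ.filter fun x => σ x = 1)ᶜ := by
      ext y
      simp only [Finset.mem_filter, Finset.mem_univ, true_and, Finset.mem_compl]
      rcases Fin.exists_fin_two.mp ⟨σ y, rfl⟩ with h0 | h1
      · simp [h0]
      · simp [h1]
    rw [h2, Finset.card_compl, Nat.cast_sub (Finset.card_le_univ _)]
    ring
  rw [hones] at hre
  linarith

/-- **Total density = particle number:** for an amplitude whose complex cast lies in the sector `M` and
with `Σ a² = 1`, `Σ_x ρ_x = |V|/2 + M`. [folklore] -/
theorem sum_siteDensity_eq {M : ℝ} (a : (V → Fin 2) → ℝ)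
    (hsec : (fun σ => (a σ : ℂ)) ∈ spinZSector (Λ := V) 1 M) (hunit : ∑ σ, a σ ^ 2 = 1) :
    (∑ x, siteDensity a x) = (Fintype.card V : ℝ) / 2 + M := by
  unfold siteDensity
  rw [Finset.sum_comm]
  have hσ : ∀ σ : V → Fin 2, (∑ x, if σ x = 0 then a σ ^ 2 else 0) =
      a σ ^ 2 * ((Fintype.card V : ℝ) / 2 + M) := by
    intro σ
    by_cases h0 : a σ = 0
    · simp [h0]
    · rw [← Finset.sum_filter, Finset.sum_const, nsmul_eq_mul, mul_comm,
        card_filter_eq_zero_of_mem_sector hsec (by exact_mod_cast h0 : (a σ : ℂ) ≠ 0)]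
  rw [Finset.sum_congr rfl fun σ _ => hσ σ, ← Finset.sum_mul, hunit, one_mul]

end General

/-! ### The torus: invariance of Perron amplitudes and uniform density -/

/-- **Perron sector ground amplitudes of the XXZ torus are automorphism-invariant** (in particular
translation-invariant). [folklore] -/
theorem perronAmplitude_comp_iso (L : ℕ) [NeZero L] (Δ M : ℝ) (a : TensorIndex (TorusSite 2 L) 2 → ℝ)
    (ha : IsPerronSectorGroundAmplitude L Δ M a) (φ : torusGraph 2 L ≃g torusGraph 2 L)
    (σ : TensorIndex (TorusSite 2 L) 2) : a (σ ∘ φ) = a σ := by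
  set ψ : TensorIndex (TorusSite 2 L) 2 → ℂ := fun σ => (a σ : ℂ) with hψ
  have hψ0 : ψ ≠ 0 := by
    intro h0
    have : ∑ σ, a σ ^ 2 = 0 := Finset.sum_eq_zero fun σ _ => by
      have := congrFun h0 σ
      simp only [hψ, Pi.zero_apply, Complex.ofReal_eq_zero] at this
      rw [this]; ring
    rw [ha.unit] at this
    exact one_ne_zero this
  obtain ⟨W, -, hMW⟩ := exists_weight_of_mem_spinZSector ha.sector hψ0
  have hsec := ha.sector
  have heig := ha.eigen
  rw [hMW] at hsec heig
  have key := xxz_sectorGroundState_comp_iso (torusGraph 2 L) (torusGraph_connected_of_proj 2 L) Δ φ W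
    hsec heig σ
  exact Complex.ofReal_injective key

/-- **`UniformSiteDensity` holds for every `L`:** the site density of a Perron sector ground amplitude of
`H(Δ)` on `(ℤ/L)²` in the sector `M` is `1/2 + M/L²` at every site. [folklore] -/
theorem siteDensity_eq_of_isPerron (L : ℕ) [NeZero L] (Δ M : ℝ) (a : TensorIndex (TorusSite 2 L) 2 → ℝ)
    (ha : IsPerronSectorGroundAmplitude L Δ M a) (x : TorusSite 2 L) :
    siteDensity a x = 1 / 2 + M / ((L : ℝ) ^ 2) := by
  -- translation covariance: every site has the density of the origin
  have hconst : ∀ y : TorusSite 2 L, siteDensity a y = siteDensity a 0 := by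
    intro y
    have h := siteDensity_comp_equiv (torusTranslationIso L y).toEquiv a
      (fun σ => perronAmplitude_comp_iso L Δ M a ha (torusTranslationIso L y) σ) 0
    have h0 : (torusTranslationIso L y).toEquiv 0 = y := by
      show (0 : TorusSite 2 L) + y = y
      rw [zero_add]
    rw [h0] at h
    exact h
  have hsum := sum_siteDensity_eq a ha.sector ha.unit
  rw [Finset.sum_congr rfl (fun y _ => hconst y), Finset.sum_const, Finset.card_univ, nsmul_eq_mul] at hsum
  have hcard : (Fintype.card (TorusSite 2 L) : ℝ) = (L : ℝ) ^ 2 := by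
    rw [Fintype.card_fun, ZMod.card, Fintype.card_fin]; push_cast; ring
  rw [hcard] at hsum
  have hL : (0 : ℝ) < (L : ℝ) ^ 2 := by
    have : (0 : ℝ) < (L : ℝ) := by exact_mod_cast Nat.pos_of_ne_zero (NeZero.ne L)
    positivity
  have key : siteDensity a 0 = ((L : ℝ) ^ 2 / 2 + M) / (L : ℝ) ^ 2 := by
    rw [← hsum, mul_comm, mul_div_assoc, div_self hL.ne', mul_one]
  rw [hconst x, key]
  have hL0 : (L : ℝ) ≠ 0 := by exact_mod_cast (NeZero.ne L)
  field_simp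

/-- **`UniformSiteDensity Δ M` HOLDS** (theory seat support statement, memo ROTOR-THEORY-7 §84), for every
anisotropy and every sector sequence. [folklore] -/
theorem uniformSiteDensity_holds (Δ : ℝ) (M : ℕ → ℝ) : UniformSiteDensity Δ M :=
  Filter.Eventually.of_forall fun L => fun aN haN x => siteDensity_eq_of_isPerron L Δ (M L) aN haN x

/-! ### Existence of Perron sector ground amplitudes -/

/-- **A non-trivial sector of the XXZ torus carries a Perron sector ground amplitude** (real,
non-negative, normalised, in the sector, eigenvector at the sector energy): the entrywise non-negative
sector ground vector of `xxz_exists_nonneg_sectorGroundState` (reducible Perron–Frobenius), normalised.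
[folklore] -/
theorem exists_perronAmplitude (L : ℕ) [NeZero L] (Δ M : ℝ)
    (hK : spinZSector (Λ := TorusSite 2 L) 1 M ≠ ⊥) :
    ∃ a : TensorIndex (TorusSite 2 L) 2 → ℝ, IsPerronSectorGroundAmplitude L Δ M a := by
  obtain ⟨W, hWatt, hMW⟩ := exists_weight_of_sector_ne_bot hK
  obtain ⟨ψ, hψ0, hψnn, hψK, hHψ⟩ := xxz_exists_nonneg_sectorGroundState (torusGraph 2 L) Δ W hWatt
  rw [← hMW] at hψK hHψ
  set b : TensorIndex (TorusSite 2 L) 2 → ℝ := fun σ => (ψ σ).re with hb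
  have hψb : ∀ σ, ψ σ = (b σ : ℂ) := fun σ =>
    Complex.ext (by simp [hb]) (by rw [Complex.ofReal_im]; exact (hψnn σ).2)
  set s : ℝ := ∑ σ, b σ ^ 2 with hs
  have hspos : 0 < s := by
    obtain ⟨σ₀, hσ₀⟩ := Function.ne_iff.mp hψ0
    have hb0 : b σ₀ ≠ 0 := by
      intro h; apply hσ₀; rw [hψb σ₀, h, Complex.ofReal_zero]; rfl
    exact lt_of_lt_of_le (by positivity : 0 < b σ₀ ^ 2)
      (Finset.single_le_sum (fun σ _ => sq_nonneg (b σ)) (Finset.mem_univ σ₀))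
  set c : ℝ := (Real.sqrt s)⁻¹ with hc
  have hcpos : 0 < c := inv_pos.mpr (Real.sqrt_pos.mpr hspos)
  refine ⟨fun σ => c * b σ, ⟨fun σ => mul_nonneg hcpos.le (hψnn σ).1, ?_, ?_, ?_⟩⟩
  · -- sector: the complex cast is `c • ψ`
    have hvec : (fun σ => ((c * b σ : ℝ) : ℂ)) = (c : ℂ) • ψ := by
      funext σ; rw [Pi.smul_apply, smul_eq_mul, hψb σ, Complex.ofReal_mul]
    rw [hvec]
    exact (spinZSector (Λ := TorusSite 2 L) 1 M).smul_mem _ hψK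
  · -- unit
    have h1 : (∑ σ, (c * b σ) ^ 2) = c ^ 2 * s := by
      rw [hs, Finset.mul_sum]
      exact Finset.sum_congr rfl fun σ _ => by ring
    rw [h1, hc, inv_pow, Real.sq_sqrt hspos.le, inv_mul_cancel₀ hspos.ne']
  · -- eigen
    have hvec : (fun σ => ((c * b σ : ℝ) : ℂ)) = (c : ℂ) • ψ := by
      funext σ; rw [Pi.smul_apply, smul_eq_mul, hψb σ, Complex.ofReal_mul]
    rw [hvec, Matrix.mulVec_smul, hHψ, smul_comm]

/-- **`PerronSectorExists` from non-triviality of the reference sectors** (theory seat support statement,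
memo ROTOR-THEORY-7 §84): if eventually the sector `M L − 1` of the `L × L` torus is non-trivial, the
reference Perron amplitudes exist. [folklore] -/
theorem perronSectorExists_of_ne_bot (Δ : ℝ) (M : ℕ → ℝ)
    (h : ∀ᶠ L : ℕ in atTop, ∀ [NeZero L], spinZSector (Λ := TorusSite 2 L) 1 (M L - 1) ≠ ⊥) :
    PerronSectorExists Δ M := by
  filter_upwards [h] with L hL
  intro _
  exact exists_perronAmplitude L Δ (M L - 1) hL

end Summit.HubbardSuperconductivity.HubbardSuperconductivity.Theorems.AnisotropyChord.InsertionEntropy
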